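import Summits.QuantumFields.YangMills.Theorems.UnitScaleTiltProp7CombTildRem2Recursion
import Summits.QuantumFields.YangMills.Theorems.UnitScaleTiltProp7CombTrueStepDefectTwoBlock
import Summits.QuantumFields.YangMills.Theorems.UnitScaleTiltProp7CornerCombFlatPieces
import HarnessLib

/-!
# Route `UnitScaleTilt`, crux K1 «MinimiserStabilityRegPr» (stmt-QuantumFields-19200), route-R E′ (A′)-on-Σ, P-A2 (β), row `hMcomb₂` ⟸ H2-1 — file H-3a
# «THE WALK MASSES OF PRINT's BLOCK LOOPS IN TWO-BLOCK `ℓ²` CURRENCY»: F-2b's step-mass hypotheses `Σ_{s ⊂ Γ}‖Y_{b(s)}‖ ≤ m` along `Γ_{c,x_r} ∪ (−c)` and `[c₋, c₊]`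
# hold with **`m := (2d+2)L·√(Σ_{s ∈ [0,L)ᵈ, ν}(‖Y(c₋+s, ν)‖² + ‖Y(c₊+s, ν)‖²))`** — hence the second-order defect recursion with sources in ★routeR-w1 F-5b's two-block letter

Cell `ym3-torus` (HUMAN RULING D-0037: YM₃ on the torus is ladder rung R3 — not d = 4, not a mass gap, not Clay), width seat `ym3-torus-px17` (gen 4); ★★OWNER RULINGS №20 (1) (`hMcomb₂`),
№22 (c); ★routeR-w1 g9 07:08:36Z.  `--supports stmt-QuantumFields-19200 --as helper`; THEOREMS ONLY (0 `def`, 0 `sorry`); count-neutral.  «route-internal row (n3)-comb₂ — NOT N06,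
NOT a print row; OPEN».  Nothing of `hMcomb`, `hMcomb₂`, H2-1, (β), `hPA2`, `hcoS`, E′, EX, the crux, d = 4 or the gap is claimed.

THE POINT.  H-2 (✓`Prop7CombTildRem2Recursion.norm_rem2_succ_sub_trueStep_le`) displays F-2b's walk masses `m` of `Y = Ũˡ[V] − 1` along the block loops of (42) at `c = (q, κ)`
as STEP sums `Σ_{s}‖stepA Y s₁ s₂‖` over `zip (scanl …) Γ`.  Every site visited by `Γ_{c,x_r} ∪ (−c) = treeWord r ++ seg κ L ++ revWord (treeWord r) ++ seg κ (−L)` from `q` lies in the two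
blocks `B(c₋) ∪ B(c₊) = [q, bondHi L q κ]` (★routeR-w1 F-5b ✓`Prop7CombTrueStepDefectTwoBlock.inBox_two_blocks`), and each step's field sits at a visited site, so every step is at
most `√M₂(c)`, `M₂(c) := Σ_{s ∈ [0,L)ᵈ}Σ_ν(‖Y(q + s, ν)‖² + ‖Y(q + Le_κ + s, ν)‖²)` (F-5b ✓`norm_le_sqrt_twoBlock` — THE SAME LETTER as F-5b's one-step DEF bound), and the loop has
`2·l1(r) + 2L ≤ (2d+2)L` steps.  The backward half `revWord (treeWord r) ++ seg κ (−L) = revWord (seg κ L ++ treeWord r)` is handled by the reversal identity `mass(p + disp w)(revWord w) =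
mass(p)(w)` (same bonds backwards), so only FORWARD words from `q` occur, whose sites ★routeR-w4 ✓`Prop7CornerCombFlatPieces.inBox_of_mem_scanl_forward` boxes.  §4 restates H-2 with
`m` discharged: the source of the `hMcomb₂` telescope at `c` is `≤ 260·((2d+2)L)²·M₂(c)` — summable over a period cell against `Σ‖Y‖²` (`hMcomb`'s currency) by F-5c-class tiling
(★routeR-w1), which is NOT done here.

WHAT IS PROVED (ns `…Theorems.Prop7CombWalkMassTwoBlock`; generic `ℤᵈ`; §1–§3 any normed ring, §4 any (nontrivial) C⋆-algebra).
* §1 `walkMass_append`, `norm_stepA_rev`, `walkMass_revWord`, `walkMass_le_length_mul` (steps at visited sites).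
* §2 `forward_treeWord_seg`, `forward_seg_treeWord`, `inBox_scanl_treeWord_seg`, `inBox_scanl_seg_treeWord`, `inBox_scanl_seg`, `norm_le_sqrt_twoBlock_of_inBox`.
* §3 ★★ `loopWord_eq_append_revWord`, `walkMass_loop_le`, `walkMass_seg_le` — F-2b's `hmL`∕`hmS` with `m := (2d+2)L·√M₂(c)`.
* §4 ★★★ `norm_rem2_succ_sub_trueStep_le_twoBlock` — H-2 with the walk masses discharged (window `72·(2d+2)L·√M₂(c) ≤ 1` displayed).
HONEST SCOPE.  List∕lattice bookkeeping; no cell sum, no member, no periodicity; H2-1 OPEN and untouched.  Rung R3, not Clay; YM gap NOT proved.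

References: T. Bałaban, CMP **98** (1985) 17–51 [Balaban1985Averaging] ((2) p.17, (9) p.18, (14) p.19, (42) p.23, p.24, (65)∕(68) p.29, Prop. 3 (113)–(126) pp.34–36); CMP **109**
(1987) 249–301 [Balaban1987RG1] ((0.4) p.253).
-/

set_option autoImplicit false

noncomputable section

open scoped BigOperators

namespace Summit.QuantumFields.YangMills.Theorems.Prop7CombWalkMassTwoBlock

open NormedSpace
open Literature.MathematicalPhysics.QuantumFieldTheory.Balaban1983to89
open ExpMeanLog (eml)
open B7Prop1Explicit (Site Letter e hol seg treeWord boxVec gammaWord Wcx Xavg expUnit stepA U1 disp revWord l1 disp_cons disp_nil disp_append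
  disp_seg disp_treeWord disp_revWord revWord_cons revWord_nil revWord_append revWord_seg length_seg length_treeWord length_revWord seg_natCast l1_boxVec_le)
open B7Prop1Local (InBox bondHi)
open B7Prop2Explicit (avgIter unitaryUnits)
open B7Eq92Concrete (tildIter)
open B7Prop3GeneralRotated (tsum)
open Summit.QuantumFields.YangMills.Theorems.Prop7CombHolRatioPerStep (zip_scanl_cons zip_scanl_nil)
open Summit.QuantumFields.YangMills.Theorems.Prop7CornerCombFlatPieces (inBox_of_mem_scanl_forward snd_eq_true_of_mem_treeWord_boxVec)
open Summit.QuantumFields.YangMills.Theorems.Prop7CombTrueStepDefectTwoBlock (inBox_two_blocks norm_le_sqrt_twoBlock)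
open Summit.QuantumFields.YangMills.Theorems.Prop7CombTildRem2Recursion (norm_rem2_succ_sub_trueStep_le)

/-! ## §1 Step-mass sums: append, reversal, length × sup -/

section WalkMass

variable {d : ℕ} {𝔸 : Type*} [NormedRing 𝔸] (Y : Site d → Fin d → 𝔸)

/-- **Append**: the step masses of `w₁ ++ w₂` from `p` are those of `w₁` from `p` plus those of `w₂` from `p + disp w₁`. [folklore] -/
theorem walkMass_append : ∀ (p : Site d) (w₁ w₂ : List (Letter d)),
    ((List.zip (List.scanl (fun (y : Site d) (l' : Letter d) => y + l'.vec) p (w₁ ++ w₂)) (w₁ ++ w₂)).map fun s => ‖stepA Y s.1 s.2‖).sum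
      = ((List.zip (List.scanl (fun (y : Site d) (l' : Letter d) => y + l'.vec) p w₁) w₁).map fun s => ‖stepA Y s.1 s.2‖).sum
        + ((List.zip (List.scanl (fun (y : Site d) (l' : Letter d) => y + l'.vec) (p + disp w₁) w₂) w₂).map fun s => ‖stepA Y s.1 s.2‖).sum
  | p, [], w₂ => by rw [zip_scanl_nil, List.nil_append, disp_nil, add_zero]; simp
  | p, l :: w₁, w₂ => by
    rw [List.cons_append, zip_scanl_cons, zip_scanl_cons, List.map_cons, List.map_cons, List.sum_cons, List.sum_cons,
      walkMass_append (p + l.vec) w₁ w₂, disp_cons, add_assoc p, add_assoc]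

/-- **A step traversed backwards has the same mass**: `‖stepA Y (p + vec l) l.rev‖ = ‖stepA Y p l‖`. [cite: Balaban1985Averaging, (9) p.18, p.24] -/
theorem norm_stepA_rev (p : Site d) (l : Letter d) : ‖stepA Y (p + l.vec) l.rev‖ = ‖stepA Y p l‖ := by
  obtain ⟨μ, b⟩ := l
  cases b <;> simp [stepA]

/-- **Reversal**: the step masses of `revWord w` from `p + disp w` equal those of `w` from `p` (same bonds, backwards). [folklore] -/
theorem walkMass_revWord : ∀ (p : Site d) (w : List (Letter d)),
    ((List.zip (List.scanl (fun (y : Site d) (l' : Letter d) => y + l'.vec) (p + disp w) (revWord w)) (revWord w)).map fun s => ‖stepA Y s.1 s.2‖).sum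
      = ((List.zip (List.scanl (fun (y : Site d) (l' : Letter d) => y + l'.vec) p w) w).map fun s => ‖stepA Y s.1 s.2‖).sum
  | p, [] => by simp
  | p, l :: w => by
    rw [revWord_cons, walkMass_append Y (p + disp (l :: w)) (revWord w) [l.rev], disp_cons, disp_revWord,
      show p + (l.vec + disp w) = (p + l.vec) + disp w by rw [add_assoc], walkMass_revWord (p + l.vec) w,
      show p + l.vec + disp w + -disp w = p + l.vec by rw [add_neg_cancel_right], zip_scanl_cons, zip_scanl_cons, zip_scanl_nil]
    simp only [List.map_cons, List.map_nil, List.sum_cons, List.sum_nil, add_zero, norm_stepA_rev]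
    exact add_comm _ _

/-- **Length × sup**: if `S` bounds `‖Y y μ‖` at every site `y` visited by `w` from `p`, the step masses sum to at most `|w|·S` (each step's field sits at its start (forward letter) or
its end (backward letter), both visited). [folklore] -/
theorem walkMass_le_length_mul {S : ℝ} : ∀ (p : Site d) (w : List (Letter d)),
    (∀ y ∈ List.scanl (fun (y : Site d) (l' : Letter d) => y + l'.vec) p w, ∀ μ, ‖Y y μ‖ ≤ S) →
    ((List.zip (List.scanl (fun (y : Site d) (l' : Letter d) => y + l'.vec) p w) w).map fun s => ‖stepA Y s.1 s.2‖).sum ≤ w.length * S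
  | p, [], _ => by simp
  | p, l :: w, hS => by
    rw [zip_scanl_cons, List.map_cons, List.sum_cons, List.length_cons, Nat.cast_succ, add_mul, one_mul, add_comm ((w.length : ℝ) * S)]
    have hp : p ∈ List.scanl (fun (y : Site d) (l' : Letter d) => y + l'.vec) p (l :: w) := by
      rw [List.scanl_cons]; exact List.mem_cons_self
    have htail : ∀ y ∈ List.scanl (fun (y : Site d) (l' : Letter d) => y + l'.vec) (p + l.vec) w, ∀ μ, ‖Y y μ‖ ≤ S :=
      fun y hy μ => hS y (by rw [List.scanl_cons]; exact List.mem_cons_of_mem _ hy) μ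
    have hpl : p + l.vec ∈ List.scanl (fun (y : Site d) (l' : Letter d) => y + l'.vec) (p + l.vec) w := by
      cases w <;> simp [List.scanl]
    refine add_le_add ?_ (walkMass_le_length_mul (p + l.vec) w htail)
    obtain ⟨μ, b⟩ := l
    cases b
    · simp only [stepA, Bool.false_eq_true, ↓reduceIte, norm_neg]
      exact htail _ hpl μ
    · simp only [stepA, ↓reduceIte]
      exact hS p hp μ

end WalkMass

/-! ## §2 The sites of the block loops lie in the two blocks -/

section Geometry

variable {d : ℕ} (L : ℕ)

/-- `treeWord (boxVec L r) ++ seg κ L` is a forward word. [folklore] -/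
theorem forward_treeWord_seg (κ : Fin d) (r : Fin d → Fin L) : ∀ l ∈ treeWord (boxVec L r) ++ seg κ (L : ℤ), l.2 = true := by
  intro l hl
  rcases List.mem_append.1 hl with h | h
  · exact snd_eq_true_of_mem_treeWord_boxVec L r h
  · rw [seg_natCast, List.mem_replicate] at h; rw [h.2]

/-- `seg κ L ++ treeWord (boxVec L r)` is a forward word. [folklore] -/
theorem forward_seg_treeWord (κ : Fin d) (r : Fin d → Fin L) : ∀ l ∈ seg κ (L : ℤ) ++ treeWord (boxVec L r), l.2 = true := by
  intro l hl
  rcases List.mem_append.1 hl with h | h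
  · rw [seg_natCast, List.mem_replicate] at h; rw [h.2]
  · exact snd_eq_true_of_mem_treeWord_boxVec L r h

/-- A forward word from `q` with displacement `boxVec L r + L•e_κ` stays in the two blocks `[q, bondHi L q κ]`. [cite: Balaban1985Averaging, (14) p.19, p.24] -/
theorem inBox_scanl_of_forward (q : Site d) (κ : Fin d) (r : Fin d → Fin L) (w : List (Letter d)) (hfw : ∀ l ∈ w, l.2 = true)
    (hdisp : disp w = boxVec L r + (L : ℤ) • e κ) :
    ∀ y ∈ List.scanl (fun (y : Site d) (l' : Letter d) => y + l'.vec) q w, InBox q (bondHi L q κ) y := by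
  intro y hy i
  have h := inBox_of_mem_scanl_forward q w hfw y hy i
  rw [hdisp] at h
  refine ⟨h.1, h.2.trans ?_⟩
  show q i + (boxVec L r + (L : ℤ) • e κ) i ≤ q i + ((L : ℤ) - 1) + if i = κ then (L : ℤ) else 0
  have hr := (r i).isLt
  simp only [Pi.add_apply, boxVec, Pi.smul_apply, B7Prop1Explicit.e_apply, smul_eq_mul, mul_ite, mul_one, mul_zero]
  split_ifs <;> omega

/-- The sites of `treeWord (boxVec L r) ++ seg κ L` from `q` lie in `[q, bondHi L q κ]`. [cite: Balaban1985Averaging, (14) p.19] -/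
theorem inBox_scanl_treeWord_seg (q : Site d) (κ : Fin d) (r : Fin d → Fin L) :
    ∀ y ∈ List.scanl (fun (y : Site d) (l' : Letter d) => y + l'.vec) q (treeWord (boxVec L r) ++ seg κ (L : ℤ)), InBox q (bondHi L q κ) y :=
  inBox_scanl_of_forward L q κ r _ (forward_treeWord_seg L κ r) (by rw [disp_append, disp_treeWord, disp_seg])

/-- The sites of `seg κ L ++ treeWord (boxVec L r)` from `q` lie in `[q, bondHi L q κ]`. [cite: Balaban1985Averaging, (14) p.19] -/
theorem inBox_scanl_seg_treeWord (q : Site d) (κ : Fin d) (r : Fin d → Fin L) :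
    ∀ y ∈ List.scanl (fun (y : Site d) (l' : Letter d) => y + l'.vec) q (seg κ (L : ℤ) ++ treeWord (boxVec L r)), InBox q (bondHi L q κ) y :=
  inBox_scanl_of_forward L q κ r _ (forward_seg_treeWord L κ r) (by rw [disp_append, disp_treeWord, disp_seg, add_comm])

/-- The sites of the straight segment `seg κ L` from `q` lie in `[q, bondHi L q κ]` (`L ≥ 1`). [cite: Balaban1985Averaging, (9) p.18] -/
theorem inBox_scanl_seg (hL : 1 ≤ L) (q : Site d) (κ : Fin d) :
    ∀ y ∈ List.scanl (fun (y : Site d) (l' : Letter d) => y + l'.vec) q (seg κ (L : ℤ)), InBox q (bondHi L q κ) y := by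
  refine inBox_scanl_of_forward L q κ (fun _ => ⟨0, hL⟩) _ (fun l hl => by rw [seg_natCast, List.mem_replicate] at hl; rw [hl.2]) ?_
  rw [disp_seg]
  funext i
  simp [boxVec]

variable {𝔸 : Type*} [NormedRing 𝔸]

/-- A field value at a site of the two blocks is at most the two-block `ℓ²` mass (F-5b ✓`inBox_two_blocks` ∘ ✓`norm_le_sqrt_twoBlock`). [folklore] -/
theorem norm_le_sqrt_twoBlock_of_inBox (hL : 1 ≤ L) (Y : Site d → Fin d → 𝔸) (q : Site d) (κ : Fin d) {y : Site d} (hy : InBox q (bondHi L q κ) y) (μ : Fin d) :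
    ‖Y y μ‖ ≤ Real.sqrt (∑ s : Fin d → Fin L, ∑ ν : Fin d, (‖Y (q + boxVec L s) ν‖ ^ 2 + ‖Y (q + (L : ℤ) • e κ + boxVec L s) ν‖ ^ 2)) := by
  rcases inBox_two_blocks L hL q κ y hy with ⟨s, rfl⟩ | ⟨s, rfl⟩
  · exact (norm_le_sqrt_twoBlock L Y q κ s μ).1
  · exact (norm_le_sqrt_twoBlock L Y q κ s μ).2

end Geometry

/-! ## §3 ★★ F-2b's walk masses in two-block currency -/

section Loops

variable {d : ℕ} (L : ℕ) {𝔸 : Type*} [NormedRing 𝔸] (Y : Site d → Fin d → 𝔸)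

/-- **The closed loop of (42) as a forward word followed by a reversed forward word**: `Γ_{c,x_r} ∪ (−c) = (treeWord r ++ seg κ L) ++ revWord (seg κ L ++ treeWord r)`
(lit `revWord_append`, `revWord_seg`). [cite: Balaban1985Averaging, (14) p.19, (42) p.23] -/
theorem loopWord_eq_append_revWord (κ : Fin d) (r : Site d) :
    gammaWord L κ r ++ seg κ (-(L : ℤ)) = (treeWord r ++ seg κ (L : ℤ)) ++ revWord (seg κ (L : ℤ) ++ treeWord r) := by
  simp only [gammaWord, revWord_append, revWord_seg, List.append_assoc]

/-- ★★ **F-2b's `hmL` IN TWO-BLOCK CURRENCY**: the step masses of `Y` along `Γ_{c,x_r} ∪ (−c)` from `q = c₋` are at most `(2d+2)L·√M₂(c)`. [cite: Balaban1985Averaging, (42) p.23, p.24, (113)-(116) pp.34-35] -/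
theorem walkMass_loop_le (hL : 1 ≤ L) (q : Site d) (κ : Fin d) (r : Fin d → Fin L) :
    ((List.zip (List.scanl (fun (y : Site d) (l' : Letter d) => y + l'.vec) q (gammaWord L κ (boxVec L r) ++ seg κ (-(L : ℤ))))
        (gammaWord L κ (boxVec L r) ++ seg κ (-(L : ℤ)))).map fun s => ‖stepA Y s.1 s.2‖).sum
      ≤ (2 * d + 2) * L * Real.sqrt (∑ s : Fin d → Fin L, ∑ ν : Fin d, (‖Y (q + boxVec L s) ν‖ ^ 2 + ‖Y (q + (L : ℤ) • e κ + boxVec L s) ν‖ ^ 2)) := by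
  set S : ℝ := Real.sqrt (∑ s : Fin d → Fin L, ∑ ν : Fin d, (‖Y (q + boxVec L s) ν‖ ^ 2 + ‖Y (q + (L : ℤ) • e κ + boxVec L s) ν‖ ^ 2)) with hS
  have hS0 : 0 ≤ S := Real.sqrt_nonneg _
  have hdisp : disp (treeWord (boxVec L r) ++ seg κ (L : ℤ)) = disp (seg κ (L : ℤ) ++ treeWord (boxVec L r)) := by
    rw [disp_append, disp_append, add_comm]
  rw [loopWord_eq_append_revWord, walkMass_append, hdisp, walkMass_revWord]
  have h1 := walkMass_le_length_mul Y q _ (fun y hy μ => norm_le_sqrt_twoBlock_of_inBox L hL Y q κ (inBox_scanl_treeWord_seg L q κ r y hy) μ)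
  have h2 := walkMass_le_length_mul Y q _ (fun y hy μ => norm_le_sqrt_twoBlock_of_inBox L hL Y q κ (inBox_scanl_seg_treeWord L q κ r y hy) μ)
  have hl1 : ((l1 (boxVec L r) : ℕ) : ℝ) ≤ (d : ℝ) * L := by exact_mod_cast l1_boxVec_le L r
  have hlen1 : (((treeWord (boxVec L r) ++ seg κ (L : ℤ)).length : ℕ) : ℝ) ≤ (d + 1) * L := by
    rw [List.length_append, length_treeWord, length_seg]
    simp only [Int.natAbs_natCast]; push_cast; linarith
  have hlen2 : (((seg κ (L : ℤ) ++ treeWord (boxVec L r)).length : ℕ) : ℝ) ≤ (d + 1) * L := by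
    rw [List.length_append, length_treeWord, length_seg]
    simp only [Int.natAbs_natCast]; push_cast; linarith
  calc _ ≤ ((treeWord (boxVec L r) ++ seg κ (L : ℤ)).length : ℝ) * S + ((seg κ (L : ℤ) ++ treeWord (boxVec L r)).length : ℝ) * S := add_le_add h1 h2
    _ ≤ (d + 1) * L * S + (d + 1) * L * S := add_le_add (mul_le_mul_of_nonneg_right hlen1 hS0) (mul_le_mul_of_nonneg_right hlen2 hS0)
    _ = (2 * d + 2) * L * S := by ring

/-- ★★ **F-2b's `hmS` IN TWO-BLOCK CURRENCY**: the step masses of `Y` along `[c₋, c₊] = seg κ L` from `q` are at most `(2d+2)L·√M₂(c)`. [cite: Balaban1985Averaging, (9) p.18, p.24] -/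
theorem walkMass_seg_le (hL : 1 ≤ L) (q : Site d) (κ : Fin d) :
    ((List.zip (List.scanl (fun (y : Site d) (l' : Letter d) => y + l'.vec) q (seg κ (L : ℤ))) (seg κ (L : ℤ))).map fun s => ‖stepA Y s.1 s.2‖).sum
      ≤ (2 * d + 2) * L * Real.sqrt (∑ s : Fin d → Fin L, ∑ ν : Fin d, (‖Y (q + boxVec L s) ν‖ ^ 2 + ‖Y (q + (L : ℤ) • e κ + boxVec L s) ν‖ ^ 2)) := by
  have hS0 : 0 ≤ Real.sqrt (∑ s : Fin d → Fin L, ∑ ν : Fin d, (‖Y (q + boxVec L s) ν‖ ^ 2 + ‖Y (q + (L : ℤ) • e κ + boxVec L s) ν‖ ^ 2)) := Real.sqrt_nonneg _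
  have h := walkMass_le_length_mul Y q _ (fun y hy μ => norm_le_sqrt_twoBlock_of_inBox L hL Y q κ (inBox_scanl_seg L hL q κ y hy) μ)
  refine h.trans (mul_le_mul_of_nonneg_right ?_ hS0)
  rw [length_seg]; simp only [Int.natAbs_natCast]
  have hd : (0 : ℝ) ≤ d := Nat.cast_nonneg _
  have hL0 : (0 : ℝ) ≤ L := Nat.cast_nonneg _
  nlinarith

end Loops

/-! ## §4 ★★★ The second-order defect recursion with two-block sources -/

section Recursion

variable {d : ℕ} {𝔸 : Type*} [CStarAlgebra 𝔸] [Nontrivial 𝔸]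

/-- ★★★ **THE SECOND-ORDER DEFECT RECURSION OF PRINT's SINGLE BARS WITH TWO-BLOCK SOURCES** (H-2 with F-2b's walk masses DISCHARGED by §3): background `Ū₀ˡ = avgIter L U₀ l` unitary-valued
with block loops `α ≤ 1∕24` at the corner `q = L•z`; `Ũˡ[V]` with values in `U1`; `Y = Ũˡ[V] − 1`; the window `72·(2d+2)L·√M₂(c) ≤ 1` on the two-block mass
`M₂(c) = Σ_{s ∈ [0,L)ᵈ}Σ_ν(‖Y(q+s,ν)‖² + ‖Y(q+Le_κ+s,ν)‖²)`.  THEN, for ANY `Y′` and ANY family `Q` with ✓p704390's linearised-tower recursion text at level `l`,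
`‖E_{l+1}(z,κ) − T_l(E_l)(L•z,κ)‖ ≤ 260·((2d+2)L)²·M₂(c)`, `E_l := (Ũˡ[V] − 1) − Q l Y′`. [cite: Balaban1985Averaging, (68)-(69) p.29, (42) p.23, Prop. 3 (113)-(126) pp.34-36; Balaban1987RG1, (0.4) p.253] -/
theorem norm_rem2_succ_sub_trueStep_le_twoBlock (L : ℕ) (hL : 1 ≤ L) (U₀ V : Site d → Fin d → 𝔸ˣ) (l : ℕ)
    (hV₀ : ∀ x μ, avgIter L U₀ l x μ ∈ unitaryUnits 𝔸) (hV₁ : ∀ x μ, tildIter L U₀ V l x μ ∈ U1 𝔸)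
    (Y : Site d → Fin d → 𝔸) (hY : ∀ x μ, Y x μ = ((tildIter L U₀ V l x μ : 𝔸ˣ) : 𝔸) - 1)
    (Q : ℕ → (Site d → Fin d → 𝔸) → Site d → Fin d → 𝔸) (Y' : Site d → Fin d → 𝔸)
    (hQs : ∀ (z : Site d) (κ : Fin d), Q (l + 1) Y' z κ
      = fderiv ℂ (eml : ((Fin d → Fin L) → 𝔸) → 𝔸) (fun r => ((Wcx L (avgIter L U₀ l) ((L : ℤ) • z) κ (boxVec L r) : 𝔸ˣ) : 𝔸))
            (fun r => tsum (avgIter L U₀ l) (Q l Y') ((L : ℤ) • z) (gammaWord L κ (boxVec L r) ++ seg κ (-(L : ℤ)))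
              * ((Wcx L (avgIter L U₀ l) ((L : ℤ) • z) κ (boxVec L r) : 𝔸ˣ) : 𝔸))
            * (((expUnit (Xavg L (avgIter L U₀ l) ((L : ℤ) • z) κ))⁻¹ : 𝔸ˣ) : 𝔸)
          + ((expUnit (Xavg L (avgIter L U₀ l) ((L : ℤ) • z) κ) : 𝔸ˣ) : 𝔸) * tsum (avgIter L U₀ l) (Q l Y') ((L : ℤ) • z) (seg κ (L : ℤ))
            * (((expUnit (Xavg L (avgIter L U₀ l) ((L : ℤ) • z) κ))⁻¹ : 𝔸ˣ) : 𝔸))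
    (z : Site d) (κ : Fin d) {α : ℝ}
    (hm72 : 72 * ((2 * d + 2) * L * Real.sqrt (∑ s : Fin d → Fin L, ∑ ν : Fin d,
      (‖Y ((L : ℤ) • z + boxVec L s) ν‖ ^ 2 + ‖Y ((L : ℤ) • z + (L : ℤ) • e κ + boxVec L s) ν‖ ^ 2))) ≤ 1)
    (hα : ∀ r : Fin d → Fin L, ‖((Wcx L (avgIter L U₀ l) ((L : ℤ) • z) κ (boxVec L r) : 𝔸ˣ) : 𝔸) - 1‖ ≤ α) (hα24 : α ≤ 1 / 24) :
    ‖(((tildIter L U₀ V (l + 1) z κ : 𝔸ˣ) : 𝔸) - 1 - Q (l + 1) Y' z κ)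
        - (fderiv ℂ (eml : ((Fin d → Fin L) → 𝔸) → 𝔸) (fun r => ((Wcx L (avgIter L U₀ l) ((L : ℤ) • z) κ (boxVec L r) : 𝔸ˣ) : 𝔸))
              (fun r => tsum (avgIter L U₀ l) (Y - Q l Y') ((L : ℤ) • z) (gammaWord L κ (boxVec L r) ++ seg κ (-(L : ℤ)))
                * ((Wcx L (avgIter L U₀ l) ((L : ℤ) • z) κ (boxVec L r) : 𝔸ˣ) : 𝔸))
              * (((expUnit (Xavg L (avgIter L U₀ l) ((L : ℤ) • z) κ))⁻¹ : 𝔸ˣ) : 𝔸)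
            + ((expUnit (Xavg L (avgIter L U₀ l) ((L : ℤ) • z) κ) : 𝔸ˣ) : 𝔸) * tsum (avgIter L U₀ l) (Y - Q l Y') ((L : ℤ) • z) (seg κ (L : ℤ))
              * (((expUnit (Xavg L (avgIter L U₀ l) ((L : ℤ) • z) κ))⁻¹ : 𝔸ˣ) : 𝔸))‖
      ≤ 260 * (((2 * d + 2) * L) ^ 2 * ∑ s : Fin d → Fin L, ∑ ν : Fin d,
          (‖Y ((L : ℤ) • z + boxVec L s) ν‖ ^ 2 + ‖Y ((L : ℤ) • z + (L : ℤ) • e κ + boxVec L s) ν‖ ^ 2)) := by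
  set M : ℝ := ∑ s : Fin d → Fin L, ∑ ν : Fin d, (‖Y ((L : ℤ) • z + boxVec L s) ν‖ ^ 2 + ‖Y ((L : ℤ) • z + (L : ℤ) • e κ + boxVec L s) ν‖ ^ 2) with hM
  have hM0 : 0 ≤ M := by positivity
  have h := norm_rem2_succ_sub_trueStep_le L U₀ V l hV₀ hV₁ Y hY Q Y' hQs z κ
    (m := (2 * d + 2) * L * Real.sqrt M) (walkMass_loop_le L Y hL _ κ) (walkMass_seg_le L Y hL _ κ) hm72 hα hα24
  have hsq : ((2 * d + 2) * L * Real.sqrt M) ^ 2 = ((2 * (d : ℝ) + 2) * L) ^ 2 * M := by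
    rw [mul_pow, Real.sq_sqrt hM0]
  rw [hsq] at h
  exact h

end Recursion

end Summit.QuantumFields.YangMills.Theorems.Prop7CombWalkMassTwoBlock

end
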